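import Summits.CriticalPhenomena.PercolationContinuityZ3.Theorems.PercAnnulusCrossingIICAtomsLowerTransfer
import Summits.CriticalPhenomena.PercolationContinuityZ3.Theorems.PercAnnulusCrossingIICMultiPointUpper
import Summits.CriticalPhenomena.PercolationContinuityZ3.Theorems.PercAnnulusCrossingRobustAnnulusUniqPlanar
import Summits.CriticalPhenomena.PercolationContinuityZ3.Theorems.PercAnnulusCrossingIICPlanarKesten
import HarnessLib

/-!
# The multipoint function of Kesten's IIC for arbitrary well-separated sites: `ν(z_0,…,z_{k−1} ∈ C(0)) ≍ C^{±k} ∏ π(‖z_i‖)` (lane RSW3, p1 gen 19)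

builds on p205010 (kernel theorem, internal audit signed; external expert review pending) — NOT used in this file (only `p_c(ℤ^d) > 0`;
planar inputs are RSW at `p_c(ℤ²) = 1/2`).

RSW3 lane (LANE 3 `prim-rsw3`), seat `prim-rsw3-p1` (gen 19).  Helper file (`--supports stmt-CriticalPhenomena-4575`);
no definitions, no sorries.  Memo `run/shared/lean/prim/rsw3/P1-QM.md` §32.

Gen 19 (7) proved the sharp lower bound for one site in each of the prescribed shells `Λ(64 v b₀ρ^i) ∖ Λ(32 v b₀ρ^i)`; here the shells are
fitted to the sites instead (`b_i = ⌈‖z_i‖/64v⌉`, gen 18 (3)'s `ceilDiv_scale_bounds`), so that the lower bound holds for ARBITRARY sites with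
`‖z_0‖ ≥ n₁` and `‖z_{i+1}‖ ≥ ρ‖z_i‖` — the same kind of hypothesis as the upper bound of gen 19 (8b) (`‖z_0‖ ≥ 4`, `‖z_{i+1}‖ ≥ 8‖z_i‖`):

* **`exists_prod_oneArmProb_le_iicMeasure_biInter_openConn_of_separated`** — (A2)□(s,L) + `CU⁺_l` + UAD at `p_c(ℤ^d)`, `d ≥ 2`: there are `ρ, n₁`
  and `c > 0` with **`c^k·∏_{i<k} π_{p_c}(‖z_i‖)·ν(univ) ≤ ν(⋂_{i<k} {0 ↔ z_i})`** for every IIC measure `ν`, every `k`, and all sites with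
  `‖z_0‖ ≥ n₁`, `‖z_{i+1}‖ ≥ ρ‖z_i‖`;
* **`exists_iicMeasure_real_biInter_openConn_two_sided_of_separated`** — with (8b): there are `ρ, n₁, c, A, C` with
  **`c^k ∏ π(‖z_i‖)·ν(univ) ≤ ν(z_0,…,z_{k−1} ∈ C(0)) ≤ A·C^k ∏ π(‖z_i‖)`** for all such sites and `k ≥ 1` — THE MULTIPOINT FUNCTION OF KESTEN'S IIC
  FACTORISES ACROSS SEPARATED SCALES;
* **`exists_iicMeasure_real_biInter_openConn_two_sided_of_separated_Z2`** — `ℤ²`, `p_c = 1/2`, UNCONDITIONAL.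
References: H. Kesten, Probab. Theory Relat. Fields 73 (1986), Thm. (8); D. Basu, A. Sapozhnikov, ECP 22 (2017).
-/

noncomputable section

namespace Summit.CriticalPhenomena.PercolationContinuityZ3.Theorems.Crossing

open MeasureTheory Filter Topology Literature.Probability.Percolation Literature.Probability.LatticeModels
open Literature.Probability.Percolation.DCT16
open Summit.CriticalPhenomena.PercolationContinuityZ3.Theorems.SurfaceTension

variable {d : ℕ}

/-- **THE SHARP MULTIPOINT LOWER BOUND FOR ARBITRARY WELL-SEPARATED SITES** (`p_c(ℤ^d)`, `d ≥ 2`; (A2)□ at aspect `(s,L)`, `2 ≤ s ≤ L`, `ϰ > 0`;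
`CU⁺_l(c_U)`, `l ≥ 2`, `c_U > 0`; UAD): there are `ρ ≥ 1`, `n₁ ≥ 1` and `c > 0` such that for every finite measure `ν` with Kesten's IIC limit
property, every `k` and all sites with `‖z_0‖_∞ ≥ n₁` and `‖z_{i+1}‖_∞ ≥ ρ·‖z_i‖_∞`:
**`c^k · ∏_{i<k} π_{p_c}(‖z_i‖_∞) · ν(univ) ≤ ν(⋂_{i<k} {0 ↔ z_i})`**.  Induction along the sites with the fitted scales `b_i = ⌈‖z_i‖/64v⌉`:
the connections found so far live in `Λ(64 l v b_{i−1}) ⊆ Λ(b_i)`, so the event is cluster-saturated at scale `b_i` and gen 19 (6) adds `z_i`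
at the sharp rate `π(64 v b_i) ≥ π(‖z_i‖)/B`. [cite: Kesten1986, Thm. (8)] [cite: BasuSapozhnikov2017ECP, Thm. 1.1] -/
theorem exists_prod_oneArmProb_le_iicMeasure_biInter_openConn_of_separated (hd : 2 ≤ d) {s L : ℕ} (hs : 2 ≤ s) (hsL : s ≤ L)
    {ϰ : ℝ} (hϰ : 0 < ϰ) (hA2 : SetToSetQuasiMultAspectAt d (criticalProbI d) s L ϰ) {l : ℕ} (hl : 2 ≤ l) {cU : ℝ} (hcU : 0 < cU)
    (hCU : ∀ a : ℕ, 1 ≤ a → ∀ E : Set (BondConfig (Site d)), IsUpperSet E → MeasurableSet E →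
      cU * (bondPercolation (zdGraph d) (criticalProbI d)).real E ≤ (bondPercolation (zdGraph d) (criticalProbI d)).real (E ∩
        {ω : BondConfig (Site d) | ∀ t ∈ innerBoundary (zdGraph d) (box d a), ∀ s ∈ innerBoundary (zdGraph d) (box d (l * a)),
          ∀ t' ∈ innerBoundary (zdGraph d) (box d a), ∀ s' ∈ innerBoundary (zdGraph d) (box d (l * a)),
          ω ∈ openConnIn (↑((box d (l * a) \ box d a) ∪ innerBoundary (zdGraph d) (box d a)) : Set (Site d)) t s →
          ω ∈ openConnIn (↑((box d (l * a) \ box d a) ∪ innerBoundary (zdGraph d) (box d a)) : Set (Site d)) t' s' →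
          ω ∈ openConnIn (↑((box d (l * a) \ box d a) ∪ innerBoundary (zdGraph d) (box d a)) : Set (Site d)) s s'}))
    (hUAD : ∀ ε : ℝ, 0 < ε → ∃ K₀ : ℕ, ∀ m : ℕ, 1 ≤ m → ∀ N : ℕ, K₀ * m ≤ N →
      (bondPercolation (zdGraph d) (criticalProbI d)).real (boxCrossing d m N) ≤ ε) :
    ∃ (ρ n₁ : ℕ) (c : ℝ), 1 ≤ ρ ∧ 1 ≤ n₁ ∧ 0 < c ∧ ∀ (ν : Measure (BondConfig (Site d))) [IsFiniteMeasure ν],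
      (∀ (F : Finset (Sym2 (Site d))) (E : Set (BondConfig (Site d))), MeasurableSet E → DeterminedBy E ↑F →
        Tendsto (fun n : ℕ => (bondPercolation (zdGraph d) (criticalProbI d)).real (E ∩ siteToBoundary d n) /
          oneArmProb d (criticalProbI d) n) atTop (𝓝 (ν.real E))) →
      ∀ (z : ℕ → Site d), n₁ ≤ Site.supNorm (z 0) → (∀ i, ρ * Site.supNorm (z i) ≤ Site.supNorm (z (i + 1))) →
        ∀ k : ℕ, c ^ k * (∏ i ∈ Finset.range k, oneArmProb d (criticalProbI d) (Site.supNorm (z i))) * ν.real Set.univ ≤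
          ν.real (⋂ i ∈ Finset.range k, (openConn (0 : Site d) (z i) : Set (BondConfig (Site d)))) := by
  have hd1 : 1 ≤ d := le_trans (by norm_num) hd
  obtain ⟨B, hB, hR2⟩ := Rsw3.exists_oneArmProb_ratio_of_setToSetQuasiMultAspectAt hd hs hsL hϰ hA2
  have hp : 0 < ((criticalProbI d : unitInterval) : ℝ) := by
    rw [coe_criticalProbI]; exact criticalProb_zd_pos d hd1
  have hπ : ∀ m : ℕ, 0 < oneArmProb d (criticalProbI d) m := fun m => oneArmProb_pos hd1 _ hp m
  have hBl : 0 < B ^ (l + 1) := pow_pos hB _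
  have hRl : ∀ j m : ℕ, 1 ≤ j → j ≤ m → m ≤ 4 * (l + 1) * j →
      oneArmProb d (criticalProbI d) j ≤ B ^ (l + 1) * oneArmProb d (criticalProbI d) m := fun j m hj hjm hm =>
    oneArmProb_ratio_iter _ hR2 hπ (l + 1) j m hj hjm (hm.trans (Nat.mul_le_mul_right j (four_mul_succ_le_eight_pow l)))
  obtain ⟨K₀, hK₀⟩ := hUAD (1 / (2 * B ^ (l + 1))) (by positivity)
  have hεB : 1 / (2 * B ^ (l + 1)) * B ^ (l + 1) ≤ 1 / 2 := le_of_eq (by field_simp)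
  have hK : 1 ≤ K₀ + 1 := by omega
  have hKK₀ : K₀ ≤ 16 * s * (K₀ + 1) := by nlinarith
  set v : ℕ := s * (K₀ + 1) with hv
  have hv1 : 1 ≤ v := by rw [hv]; nlinarith
  set c' : ℝ := cU / (2 * B ^ (l + 1)) with hc'
  have hc'0 : 0 ≤ c' := by positivity
  refine ⟨128 * l * v, 64 * v, c' / B, by nlinarith, by omega, by positivity, fun ν _ hν z hz0 hsep k => ?_⟩
  -- norms and fitted scales
  set n : ℕ → ℕ := fun i => Site.supNorm (z i) with hn
  have hn64 : ∀ i, 64 * v ≤ n i := by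
    intro i
    induction i with
    | zero => exact hz0
    | succ i ih =>
      have h := hsep i
      have : n i ≤ 128 * l * v * n i := Nat.le_mul_of_pos_left _ (by positivity)
      simp only [hn] at ih this h ⊢; omega
  set b : ℕ → ℕ := fun i => (n i + 64 * v - 1) / (64 * v) with hb
  have hbnd : ∀ i, 1 ≤ b i ∧ 32 * (v * b i) < n i ∧ n i ≤ 64 * (v * b i) ∧ 64 * (v * b i) < n i + 64 * v :=
    fun i => ceilDiv_scale_bounds hv1 (hn64 i)
  have hz' : ∀ i, z i ∈ box d (64 * (s * (K₀ + 1) * b i)) \ box d (32 * (s * (K₀ + 1) * b i)) := by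
    intro i
    obtain ⟨-, h32, h64, -⟩ := hbnd i
    rw [← hv, Finset.mem_sdiff, mem_box_iff_supNorm_le, mem_box_iff_supNorm_le]
    simp only [hn] at h32 h64
    constructor
    · rw [show 64 * (v * b i) = 64 * (v * b i) from rfl] at h64; linarith [h64]
    · omega
  -- the next fitted scale dominates the previous target box: `64 l v b_i ≤ b_{i+1}`
  have hMb : ∀ i, l * (64 * (v * b i)) ≤ b (i + 1) := by
    intro i
    obtain ⟨-, h32, -, -⟩ := hbnd i
    obtain ⟨-, -, h64', -⟩ := hbnd (i + 1)
    have h := hsep i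
    simp only [hn] at h32 h64' h
    -- `64 v · (64 l v b_i) = 128 l v · (32 v b_i) < 128 l v · n_i ≤ n_{i+1} ≤ 64 v · b_{i+1}`
    have h1 : 64 * v * (l * (64 * (v * b i))) < 64 * v * b (i + 1) := by
      calc 64 * v * (l * (64 * (v * b i))) = 128 * l * v * (32 * (v * b i)) := by ring
        _ < 128 * l * v * Site.supNorm (z i) := Nat.mul_lt_mul_of_pos_left h32 (by positivity)
        _ ≤ Site.supNorm (z (i + 1)) := h
        _ ≤ 64 * (v * b (i + 1)) := h64'
        _ = 64 * v * b (i + 1) := by ring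
    exact (Nat.lt_of_mul_lt_mul_left h1).le
  -- the induction: connections inside the target boxes `Λ(64 l v b_{k-1})`
  have hind : ∀ k, (∏ i ∈ Finset.range k, c' * oneArmProb d (criticalProbI d) (64 * (s * (K₀ + 1) * b i))) * ν.real Set.univ ≤
      ν.real (⋂ i ∈ Finset.range k, openConnIn (↑(box d (l * (64 * (s * (K₀ + 1) * b (k - 1))))) : Set (Site d)) 0 (z i)) := by
    intro k
    induction k with
    | zero => simp
    | succ k ih =>
      -- the event so far, read in `Λ(b_k)`
      set H : Set (BondConfig (Site d)) := ⋂ i ∈ Finset.range k, openConnIn (↑(box d (b k)) : Set (Site d)) 0 (z i) with hH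
      have hHl : IsLocalEvent H :=
        ⟨(box d (b k)).sym2, DeterminedBy.iInter fun i => DeterminedBy.iInter fun _ => determinedBy_openConnIn _ 0 (z i) (by rw [Finset.coe_sym2])⟩
      have hprev : (⋂ i ∈ Finset.range k, openConnIn (↑(box d (l * (64 * (s * (K₀ + 1) * b (k - 1))))) : Set (Site d)) 0 (z i)) ⊆ H := by
        rcases Nat.eq_zero_or_pos k with rfl | hk
        · simp [hH]
        · have hle : l * (64 * (s * (K₀ + 1) * b (k - 1))) ≤ b k := by
            have h := hMb (k - 1)
            rw [show k - 1 + 1 = k by omega, hv] at h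
            exact h
          rw [hH]
          exact Set.biInter_mono (fun i hi => hi) fun i _ => openConnIn_mono (Finset.coe_subset.2 (box_mono d hle)) (0 : Site d) (z i)
      have hstep := mul_iicMeasure_real_inter_openConnIn_le_of_saturated (criticalProbI d) hl hcU.le hCU hBl hεB hK₀ hRl hν hs hK hKK₀
        (hbnd k).1 hHl (biInter_openConnIn_saturated (b k) (Finset.range k) z) (hz' k)
      have hθ : 0 ≤ c' * oneArmProb d (criticalProbI d) (64 * (s * (K₀ + 1) * b k)) := mul_nonneg hc'0 (hπ _).le
      have hsub : H ∩ openConnIn (↑(box d (l * (64 * (s * (K₀ + 1) * b k)))) : Set (Site d)) 0 (z k) ⊆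
          ⋂ i ∈ Finset.range (k + 1), openConnIn (↑(box d (l * (64 * (s * (K₀ + 1) * b (k + 1 - 1))))) : Set (Site d)) 0 (z i) := by
        rintro ω ⟨hωH, hωk⟩
        rw [show k + 1 - 1 = k by omega, Finset.range_add_one, Finset.set_biInter_insert]
        refine ⟨hωk, ?_⟩
        have hle : b k ≤ l * (64 * (s * (K₀ + 1) * b k)) := by
          have h1 : b k ≤ s * (K₀ + 1) * b k := Nat.le_mul_of_pos_left _ (by positivity)
          have h3 : 64 * (s * (K₀ + 1) * b k) ≤ l * (64 * (s * (K₀ + 1) * b k)) := Nat.le_mul_of_pos_left _ (by omega)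
          omega
        rw [hH] at hωH
        exact Set.biInter_mono (fun i hi => hi) (fun i _ => openConnIn_mono (Finset.coe_subset.2 (box_mono d hle)) (0 : Site d) (z i)) hωH
      rw [Finset.prod_range_succ]
      calc (∏ i ∈ Finset.range k, c' * oneArmProb d (criticalProbI d) (64 * (s * (K₀ + 1) * b i))) *
            (c' * oneArmProb d (criticalProbI d) (64 * (s * (K₀ + 1) * b k))) * ν.real Set.univ
          = c' * oneArmProb d (criticalProbI d) (64 * (s * (K₀ + 1) * b k)) *
              ((∏ i ∈ Finset.range k, c' * oneArmProb d (criticalProbI d) (64 * (s * (K₀ + 1) * b i))) * ν.real Set.univ) := by ring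
        _ ≤ c' * oneArmProb d (criticalProbI d) (64 * (s * (K₀ + 1) * b k)) * ν.real H :=
            mul_le_mul_of_nonneg_left (ih.trans (measureReal_mono hprev)) hθ
        _ ≤ ν.real (H ∩ openConnIn (↑(box d (l * (64 * (s * (K₀ + 1) * b k)))) : Set (Site d)) 0 (z k)) := hstep
        _ ≤ ν.real (⋂ i ∈ Finset.range (k + 1), openConnIn (↑(box d (l * (64 * (s * (K₀ + 1) * b (k + 1 - 1))))) : Set (Site d)) 0 (z i)) :=
            measureReal_mono hsub
  -- price per site: `(c'/B)·π(n_i) ≤ c'·π(64 v b_i)`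
  have hfac : ∀ i, c' / B * oneArmProb d (criticalProbI d) (n i) ≤ c' * oneArmProb d (criticalProbI d) (64 * (s * (K₀ + 1) * b i)) := by
    intro i
    obtain ⟨-, h32, h64, h2n⟩ := hbnd i
    have hratio := hR2 (n i) (64 * (s * (K₀ + 1) * b i)) (by have := hn64 i; omega) (by rw [← hv]; linarith [h64])
      (by rw [← hv]; have := hn64 i; linarith [h2n])
    rw [div_mul_eq_mul_div, div_le_iff₀ hB]
    calc c' * oneArmProb d (criticalProbI d) (n i) ≤ c' * (B * oneArmProb d (criticalProbI d) (64 * (s * (K₀ + 1) * b i))) :=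
          mul_le_mul_of_nonneg_left hratio hc'0
      _ = c' * oneArmProb d (criticalProbI d) (64 * (s * (K₀ + 1) * b i)) * B := by ring
  have hprod : (c' / B) ^ k * ∏ i ∈ Finset.range k, oneArmProb d (criticalProbI d) (n i) ≤
      ∏ i ∈ Finset.range k, c' * oneArmProb d (criticalProbI d) (64 * (s * (K₀ + 1) * b i)) := by
    rw [← Finset.card_range k, ← Finset.prod_const, Finset.card_range, ← Finset.prod_mul_distrib]
    exact Finset.prod_le_prod (fun i _ => mul_nonneg (by positivity) (hπ _).le) fun i _ => hfac i
  have hglob : ν.real (⋂ i ∈ Finset.range k, openConnIn (↑(box d (l * (64 * (s * (K₀ + 1) * b (k - 1))))) : Set (Site d)) 0 (z i)) ≤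
      ν.real (⋂ i ∈ Finset.range k, (openConn (0 : Site d) (z i) : Set (BondConfig (Site d)))) :=
    measureReal_mono (Set.biInter_mono (fun i hi => hi) fun i _ ω hω => DCT16.reachable_of_pathIn (pathIn_of_mem_openConnIn hω))
  calc (c' / B) ^ k * (∏ i ∈ Finset.range k, oneArmProb d (criticalProbI d) (Site.supNorm (z i))) * ν.real Set.univ
      ≤ (∏ i ∈ Finset.range k, c' * oneArmProb d (criticalProbI d) (64 * (s * (K₀ + 1) * b i))) * ν.real Set.univ :=
        mul_le_mul_of_nonneg_right hprod measureReal_nonneg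
    _ ≤ _ := hind k
    _ ≤ _ := hglob

/-- **THE MULTIPOINT FUNCTION OF KESTEN'S IIC FACTORISES ACROSS SEPARATED SCALES** (`p_c(ℤ^d)`, `d ≥ 2`; (A2)□ at aspect `(s,L)`, `2 ≤ s ≤ L`,
`ϰ > 0`; `CU⁺_l(c_U)`, `l ≥ 2`, `c_U > 0`; UAD): there are `ρ, n₁ ≥ 1` and `c, A, C > 0` such that for every finite measure `ν` with Kesten's
IIC limit property, every `k ≥ 1` and all sites with `‖z_0‖_∞ ≥ n₁` and `‖z_{i+1}‖_∞ ≥ ρ·‖z_i‖_∞`: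
**`c^k·∏_{i<k} π_{p_c}(‖z_i‖_∞)·ν(univ) ≤ ν(⋂_{i<k} {0 ↔ z_i}) ≤ A·C^k·∏_{i<k} π_{p_c}(‖z_i‖_∞)`**. [cite: Kesten1986, Thm. (8)]
[cite: BasuSapozhnikov2017ECP, Thm. 1.1] -/
theorem exists_iicMeasure_real_biInter_openConn_two_sided_of_separated (hd : 2 ≤ d) {s L : ℕ} (hs : 2 ≤ s) (hsL : s ≤ L)
    {ϰ : ℝ} (hϰ : 0 < ϰ) (hA2 : SetToSetQuasiMultAspectAt d (criticalProbI d) s L ϰ) {l : ℕ} (hl : 2 ≤ l) {cU : ℝ} (hcU : 0 < cU)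
    (hCU : ∀ a : ℕ, 1 ≤ a → ∀ E : Set (BondConfig (Site d)), IsUpperSet E → MeasurableSet E →
      cU * (bondPercolation (zdGraph d) (criticalProbI d)).real E ≤ (bondPercolation (zdGraph d) (criticalProbI d)).real (E ∩
        {ω : BondConfig (Site d) | ∀ t ∈ innerBoundary (zdGraph d) (box d a), ∀ s ∈ innerBoundary (zdGraph d) (box d (l * a)),
          ∀ t' ∈ innerBoundary (zdGraph d) (box d a), ∀ s' ∈ innerBoundary (zdGraph d) (box d (l * a)),
          ω ∈ openConnIn (↑((box d (l * a) \ box d a) ∪ innerBoundary (zdGraph d) (box d a)) : Set (Site d)) t s →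
          ω ∈ openConnIn (↑((box d (l * a) \ box d a) ∪ innerBoundary (zdGraph d) (box d a)) : Set (Site d)) t' s' →
          ω ∈ openConnIn (↑((box d (l * a) \ box d a) ∪ innerBoundary (zdGraph d) (box d a)) : Set (Site d)) s s'}))
    (hUAD : ∀ ε : ℝ, 0 < ε → ∃ K₀ : ℕ, ∀ m : ℕ, 1 ≤ m → ∀ N : ℕ, K₀ * m ≤ N →
      (bondPercolation (zdGraph d) (criticalProbI d)).real (boxCrossing d m N) ≤ ε) :
    ∃ (ρ n₁ : ℕ) (c A C : ℝ), 1 ≤ ρ ∧ 1 ≤ n₁ ∧ 0 < c ∧ 0 < A ∧ 0 < C ∧ ∀ (ν : Measure (BondConfig (Site d))) [IsFiniteMeasure ν],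
      (∀ (F : Finset (Sym2 (Site d))) (E : Set (BondConfig (Site d))), MeasurableSet E → DeterminedBy E ↑F →
        Tendsto (fun n : ℕ => (bondPercolation (zdGraph d) (criticalProbI d)).real (E ∩ siteToBoundary d n) /
          oneArmProb d (criticalProbI d) n) atTop (𝓝 (ν.real E))) →
      ∀ (z : ℕ → Site d), n₁ ≤ Site.supNorm (z 0) → (∀ i, ρ * Site.supNorm (z i) ≤ Site.supNorm (z (i + 1))) →
        ∀ k : ℕ, 1 ≤ k →
          c ^ k * (∏ i ∈ Finset.range k, oneArmProb d (criticalProbI d) (Site.supNorm (z i))) * ν.real Set.univ ≤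
              ν.real (⋂ i ∈ Finset.range k, (openConn (0 : Site d) (z i) : Set (BondConfig (Site d)))) ∧
            ν.real (⋂ i ∈ Finset.range k, (openConn (0 : Site d) (z i) : Set (BondConfig (Site d)))) ≤
              A * C ^ k * ∏ i ∈ Finset.range k, oneArmProb d (criticalProbI d) (Site.supNorm (z i)) := by
  obtain ⟨ρ, n₁, c, hρ, hn₁, hc, hlow⟩ :=
    exists_prod_oneArmProb_le_iicMeasure_biInter_openConn_of_separated hd hs hsL hϰ hA2 hl hcU hCU hUAD
  obtain ⟨A, C, hA, hC, hup⟩ := exists_iicMeasure_real_biInter_openConn_le_criticalProbI hd hs hsL hϰ hA2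
  refine ⟨max ρ 8, max n₁ 4, c, A, C, le_trans hρ (le_max_left _ _), le_trans hn₁ (le_max_left _ _), hc, hA, hC,
    fun ν _ hν z hz0 hsep k hk => ⟨?_, ?_⟩⟩
  · exact hlow ν hν z (le_trans (le_max_left _ _) hz0) (fun i => le_trans (Nat.mul_le_mul_right _ (le_max_left _ _)) (hsep i)) k
  · exact hup ν hν (fun i => Site.supNorm (z i)) (le_trans (le_max_right _ _) hz0)
      (fun i => le_trans (Nat.mul_le_mul_right _ (le_max_right _ _)) (hsep i)) z (fun i => self_mem_sphere (z i)) k hk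

/-- **PLANAR, UNCONDITIONAL**: at `p_c(ℤ²) = 1/2` there are `ρ, n₁ ≥ 1` and `c, A, C > 0` with
**`c^k·∏_{i<k} π(‖z_i‖_∞)·ν(univ) ≤ ν(z_0,…,z_{k−1} ∈ C(0)) ≤ A·C^k·∏_{i<k} π(‖z_i‖_∞)`** for every planar IIC measure `ν`, every `k ≥ 1` and all sites
with `‖z_0‖ ≥ n₁`, `‖z_{i+1}‖ ≥ ρ‖z_i‖` (`CU⁺_9`, UAD and (A2)□ from RSW). [cite: Kesten1986, Thm. (8)] -/
theorem exists_iicMeasure_real_biInter_openConn_two_sided_of_separated_Z2 :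
    ∃ (ρ n₁ : ℕ) (c A C : ℝ), 1 ≤ ρ ∧ 1 ≤ n₁ ∧ 0 < c ∧ 0 < A ∧ 0 < C ∧ ∀ (ν : Measure (BondConfig (Site 2))) [IsFiniteMeasure ν],
      (∀ (F : Finset (Sym2 (Site 2))) (E : Set (BondConfig (Site 2))), MeasurableSet E → DeterminedBy E ↑F →
        Tendsto (fun n : ℕ => (bondPercolation (zdGraph 2) (criticalProbI 2)).real (E ∩ siteToBoundary 2 n) /
          oneArmProb 2 (criticalProbI 2) n) atTop (𝓝 (ν.real E))) →
      ∀ (z : ℕ → Site 2), n₁ ≤ Site.supNorm (z 0) → (∀ i, ρ * Site.supNorm (z i) ≤ Site.supNorm (z (i + 1))) →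
        ∀ k : ℕ, 1 ≤ k →
          c ^ k * (∏ i ∈ Finset.range k, oneArmProb 2 (criticalProbI 2) (Site.supNorm (z i))) * ν.real Set.univ ≤
              ν.real (⋂ i ∈ Finset.range k, (openConn (0 : Site 2) (z i) : Set (BondConfig (Site 2)))) ∧
            ν.real (⋂ i ∈ Finset.range k, (openConn (0 : Site 2) (z i) : Set (BondConfig (Site 2)))) ≤
              A * C ^ k * ∏ i ∈ Finset.range k, oneArmProb 2 (criticalProbI 2) (Site.supNorm (z i)) := by
  obtain ⟨cU, hcU, hCU⟩ := robustCondAnnulusUniq_Z2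
  have hA2 := setToSetQuasiMultAspectAt_of_robustCondAnnulusUniq (d := 2) le_rfl (l := 9) (by norm_num) hcU.le (hCU 9 le_rfl)
  exact exists_iicMeasure_real_biInter_openConn_two_sided_of_separated (d := 2) le_rfl (by norm_num) (by norm_num) (by positivity) hA2
    (by norm_num) hcU (hCU 9 le_rfl) uad_Z2

end Summit.CriticalPhenomena.PercolationContinuityZ3.Theorems.Crossing

end
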